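import Summits.QuantumFields.YangMills.Theorems.LuscherReductionTwistedTraceScalingToronMinimality
import Mathlib.Analysis.Convex.SpecificFunctions.Deriv
import Mathlib.Analysis.SpecialFunctions.Arsinh
import Mathlib.Analysis.Normed.Group.AddCircle
import HarnessLib

/-!
# The one-dimensional massless gain is LINEAR in the distance of the twist to the torons:
# `gain1 L κ a ≥ c_{L,κ} · ‖a‖_{ℝ/(2π/L)ℤ}` with `c_{L,κ} = gain1 L κ (π/L)·L/π > 0`, hence
# `toronZPE L κ 0 0 + c_{L,κ}·‖α_k‖ ≤ toronZPE L κ 0 α` — the transverse zero-point gain of the VALLEY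
# (crux `TwistedTraceScaling` stmt-QuantumFields-20203, S-BASE, both COARSE lanes; design note `pub/ym-fleet/ym-luscher-20007-p1/COARSE-DESIGN.md` §12)

`…ToronMinimality` reduced the gain of the charged-mode zero-point energy over the torons to the one-dimensional massless gain
`gain1 L κ a = Σ_{i<L} [h(a + 2πi/L) − h(2πi/L)]`, `h(x) = ½arcosh(1 + κ(2 − 2cos x)) = arsinh(√(2κ)·sin(x/2))` on `[0, 2π]`.  Since `arsinh` is
concave increasing on `[0,∞)` and `sin(·/2)` is strictly concave on `[0, 2π]`, `h` is strictly concave there, so `a ↦ Σ_i h(a + 2πi/L)` is strictly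
concave on one period `[0, 2π/L]` with equal end values: it lies above the two chords through its midpoint value.  Results:

* `modeZPE_eq_arsinh` (`½arcosh(1 + κ(2 − 2cos x)) = arsinh(√(2κ) sin(x/2))` on `[0,2π]`; `2 − 2cos x = 4sin²(x/2)` as in `BalabanUV…two_sub_two_mul_cos`), `concaveOn_arsinh_Ici`, `strictConcaveOn_modeZPE_comp`;
* `gain1_add_period`, `gain1_add_int_mul_period` (period `2π/L`); ★ `gain1Slope_pos`; ★ `gain1_ge_slope_mul_min` (`0 ≤ a ≤ 2π/L`);
* ★★ `gain1_ge_slope_mul_norm : gain1Slope L κ · ‖(a : AddCircle (2π/L))‖ ≤ gain1 L κ a`;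
* ★★★ `toronZPE_zero_add_slope_mul_norm_le : toronZPE L κ 0 0 + gain1Slope L κ · ‖(α k : AddCircle (2π/L))‖ ≤ toronZPE L κ 0 α` — the zero-point
  energy of a flat background exceeds the toron value by a constant times the distance of ANY of its adjoint holonomy phases to `(2π/L)ℤ`
  (the linear "transverse zero-point" confinement of the toron valley, Lüscher 1983 §3, at one loop on the lattice, every `L ≥ 1`, every `κ > 0`).

HONEST FRAMING: real analysis of finite `arcosh` sums; the identification with the stiff spectrum and the valley row bound are NOT done here; femto
rung R2b1 (brick for a stub of a child of a CONDITIONAL route); not a gap, not Clay.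
-/

set_option autoImplicit false

noncomputable section

open Finset Set
open scoped BigOperators

namespace Summit.QuantumFields.YangMills.Theorems.FemtoTransferGap.TwoLattice.Toron

/-! ## §1 `h = arsinh(√(2κ) sin(·/2))` and its strict concavity on `[0, 2π]` -/

/-- `arcosh(1 + 2u²) = 2·arsinh u` for `u ≥ 0`. [folklore] -/
theorem arcosh_one_add_two_mul_sq {u : ℝ} (hu : 0 ≤ u) : Real.arcosh (1 + 2 * u ^ 2) = 2 * Real.arsinh u := by
  have h : Real.cosh (2 * Real.arsinh u) = 1 + 2 * u ^ 2 := by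
    rw [Real.cosh_two_mul, Real.cosh_sq, Real.sinh_arsinh]; ring
  rw [← h, Real.arcosh_cosh]
  have := Real.arsinh_nonneg_iff.mpr hu
  positivity

/-- ★ On `[0, 2π]`: `modeZPE (κ(2 − 2cos x)) = arsinh(√(2κ)·sin(x/2))` (`κ ≥ 0`). [folklore] -/
theorem modeZPE_eq_arsinh {κ : ℝ} (hκ : 0 ≤ κ) {x : ℝ} (hx : x ∈ Icc 0 (2 * Real.pi)) :
    modeZPE (κ * (2 - 2 * Real.cos x)) = Real.arsinh (Real.sqrt (2 * κ) * Real.sin (x / 2)) := by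
  have hs : 0 ≤ Real.sin (x / 2) :=
    Real.sin_nonneg_of_nonneg_of_le_pi (by linarith [hx.1]) (by linarith [hx.2])
  have hu : 0 ≤ Real.sqrt (2 * κ) * Real.sin (x / 2) := mul_nonneg (Real.sqrt_nonneg _) hs
  have h2c : 2 - 2 * Real.cos x = 4 * Real.sin (x / 2) ^ 2 := by
    have h : Real.cos x = Real.cos (2 * (x / 2)) := by ring_nf
    rw [h, Real.cos_two_mul, Real.cos_sq']; ring
  unfold modeZPE
  rw [h2c, show 1 + κ * (4 * Real.sin (x / 2) ^ 2) = 1 + 2 * (Real.sqrt (2 * κ) * Real.sin (x / 2)) ^ 2 by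
    rw [mul_pow, Real.sq_sqrt (by positivity)]; ring, arcosh_one_add_two_mul_sq hu]
  ring

/-- `arsinh` is concave on `[0, ∞)`. [folklore] -/
theorem concaveOn_arsinh_Ici : ConcaveOn ℝ (Ici (0 : ℝ)) Real.arsinh := by
  refine AntitoneOn.concaveOn_of_deriv (convex_Ici 0) Real.continuous_arsinh.continuousOn
    Real.differentiable_arsinh.differentiableOn ?_
  rw [interior_Ici]
  intro x hx y hy hxy
  rw [(Real.hasDerivAt_arsinh x).deriv, (Real.hasDerivAt_arsinh y).deriv]
  have hx' : 0 < x := hx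
  have h1 : Real.sqrt (1 + x ^ 2) ≤ Real.sqrt (1 + y ^ 2) := Real.sqrt_le_sqrt (by nlinarith)
  exact inv_anti₀ (Real.sqrt_pos.mpr (by positivity)) h1

/-- `x ↦ c·sin(x/2)` is strictly concave on `[0, 2π]` for `c > 0`. [folklore] -/
theorem strictConcaveOn_mul_sin_half {c : ℝ} (hc : 0 < c) :
    StrictConcaveOn ℝ (Icc 0 (2 * Real.pi)) (fun x => c * Real.sin (x / 2)) := by
  refine ⟨convex_Icc _ _, fun x hx y hy hxy a b ha hb hab => ?_⟩
  have hx' : x / 2 ∈ Icc 0 Real.pi := ⟨by linarith [hx.1], by linarith [hx.2]⟩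
  have hy' : y / 2 ∈ Icc 0 Real.pi := ⟨by linarith [hy.1], by linarith [hy.2]⟩
  have hxy' : x / 2 ≠ y / 2 := fun h => hxy (by linarith)
  have h := strictConcaveOn_sin_Icc.2 hx' hy' hxy' ha hb hab
  simp only [smul_eq_mul] at h ⊢
  rw [show (a * x + b * y) / 2 = a * (x / 2) + b * (y / 2) by ring]
  nlinarith

/-- Composition: a concave strictly increasing outer function of a strictly concave inner function is strictly concave. [folklore] -/
theorem strictConcaveOn_comp_of_concaveOn {s : Set ℝ} {t : Set ℝ} {g f : ℝ → ℝ} (hg : ConcaveOn ℝ t g)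
    (hgm : StrictMonoOn g t) (hf : StrictConcaveOn ℝ s f) (hmaps : MapsTo f s t) : StrictConcaveOn ℝ s (fun x => g (f x)) := by
  refine ⟨hf.1, fun x hx y hy hxy a b ha hb hab => ?_⟩
  have h1 : a • f x + b • f y < f (a • x + b • y) := hf.2 hx hy hxy ha hb hab
  have hmem : a • f x + b • f y ∈ t := hg.1 (hmaps hx) (hmaps hy) ha.le hb.le hab
  have hmem' : f (a • x + b • y) ∈ t := hmaps (hf.1 hx hy ha.le hb.le hab)
  have h2 : g (a • f x + b • f y) < g (f (a • x + b • y)) := hgm hmem hmem' h1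
  have h3 : a • g (f x) + b • g (f y) ≤ g (a • f x + b • f y) := hg.2 (hmaps hx) (hmaps hy) ha.le hb.le hab
  exact h3.trans_lt h2

/-- ★ `h(x) = arsinh(√(2κ) sin(x/2))` is strictly concave on `[0, 2π]` (`κ > 0`). [folklore] -/
theorem strictConcaveOn_arsinh_sin_half {κ : ℝ} (hκ : 0 < κ) :
    StrictConcaveOn ℝ (Icc 0 (2 * Real.pi)) (fun x => Real.arsinh (Real.sqrt (2 * κ) * Real.sin (x / 2))) := by
  refine strictConcaveOn_comp_of_concaveOn concaveOn_arsinh_Ici (Real.arsinh_strictMono.strictMonoOn _)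
    (strictConcaveOn_mul_sin_half (Real.sqrt_pos.mpr (by positivity))) fun x hx => ?_
  exact mul_nonneg (Real.sqrt_nonneg _) (Real.sin_nonneg_of_nonneg_of_le_pi (by linarith [hx.1]) (by linarith [hx.2]))

/-! ## §2 The one-period sum `F(a) = Σ_i modeZPE(κ·lap1 L a i)` is strictly concave on `[0, 2π/L]` -/

/-- The one-period sum. [folklore] -/
def periodSum (L : ℕ) (κ a : ℝ) : ℝ := ∑ i : Fin L, modeZPE (κ * lap1 L a i)

/-- `gain1 L κ a = periodSum L κ a − periodSum L κ 0`. [folklore] -/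
theorem gain1_eq_periodSum_sub (L : ℕ) (κ a : ℝ) : gain1 L κ a = periodSum L κ a - periodSum L κ 0 := by
  unfold gain1 periodSum; rw [sum_sub_distrib]

/-- For `a ∈ [0, 2π/L]` and `i < L` the angle `a + 2πi/L` lies in `[0, 2π]`. [folklore] -/
theorem angle_mem_Icc (L : ℕ) [NeZero L] {a : ℝ} (ha : a ∈ Icc 0 (2 * Real.pi / L)) (i : Fin L) :
    a + 2 * Real.pi * (i : ℕ) / L ∈ Icc 0 (2 * Real.pi) := by
  have hL : (0 : ℝ) < L := by exact_mod_cast Nat.pos_of_ne_zero (NeZero.ne L)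
  have hi : ((i : ℕ) : ℝ) + 1 ≤ L := by exact_mod_cast Nat.succ_le_of_lt i.isLt
  have hi0 : (0 : ℝ) ≤ (i : ℕ) := by positivity
  refine ⟨by have := ha.1; positivity, ?_⟩
  have h2 : a ≤ 2 * Real.pi / L := ha.2
  rw [le_div_iff₀ hL] at h2
  have : (a + 2 * Real.pi * (i : ℕ) / L) * L ≤ 2 * Real.pi * L := by
    rw [add_mul, div_mul_cancel₀ _ hL.ne']; nlinarith [Real.pi_pos]
  exact le_of_mul_le_mul_right this hL

/-- ★ The one-period sum is strictly concave on `[0, 2π/L]` (`κ > 0`, `L ≥ 1`). [folklore] -/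
theorem strictConcaveOn_periodSum (L : ℕ) [NeZero L] {κ : ℝ} (hκ : 0 < κ) :
    StrictConcaveOn ℝ (Icc 0 (2 * Real.pi / L)) (periodSum L κ) := by
  refine ⟨convex_Icc _ _, fun x hx y hy hxy a b ha hb hab => ?_⟩
  unfold periodSum
  simp only [smul_eq_mul, mul_sum]
  rw [← sum_add_distrib]
  refine sum_lt_sum_of_nonempty univ_nonempty fun i _ => ?_
  have hxi := angle_mem_Icc L hx i
  have hyi := angle_mem_Icc L hy i
  have hne : x + 2 * Real.pi * (i : ℕ) / L ≠ y + 2 * Real.pi * (i : ℕ) / L := fun h => hxy (by linarith)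
  have h := (strictConcaveOn_arsinh_sin_half hκ).2 hxi hyi hne ha hb hab
  simp only [smul_eq_mul] at h
  have hmem : a * (x + 2 * Real.pi * (i : ℕ) / L) + b * (y + 2 * Real.pi * (i : ℕ) / L) ∈ Icc 0 (2 * Real.pi) := by
    have := (convex_Icc (0 : ℝ) (2 * Real.pi)) hxi hyi ha.le hb.le hab
    simpa only [smul_eq_mul] using this
  unfold lap1
  rw [show a * x + b * y + 2 * Real.pi * (i : ℕ) / L =
    a * (x + 2 * Real.pi * (i : ℕ) / L) + b * (y + 2 * Real.pi * (i : ℕ) / L) by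
      linear_combination (-(2 * Real.pi * (i : ℕ) / L)) * hab]
  rw [modeZPE_eq_arsinh hκ.le hxi, modeZPE_eq_arsinh hκ.le hyi, modeZPE_eq_arsinh hκ.le hmem]
  exact h

/-! ## §3 Periodicity and the linear lower bound on one period -/

/-- `gain1` has period `2π/L`. [folklore] -/
theorem gain1_add_period (L : ℕ) [NeZero L] (κ a : ℝ) : gain1 L κ (a + 2 * Real.pi / L) = gain1 L κ a := by
  rw [gain1_eq_periodSum_sub, gain1_eq_periodSum_sub]
  congr 1
  unfold periodSum
  simp_rw [lap1_add_period]
  exact Equiv.sum_comp (Equiv.addRight (1 : Fin L)) (fun i => modeZPE (κ * lap1 L a i))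

/-- `gain1` is invariant under integer multiples of the period. [folklore] -/
theorem gain1_add_int_mul_period (L : ℕ) [NeZero L] (κ a : ℝ) (n : ℤ) :
    gain1 L κ (a + n * (2 * Real.pi / L)) = gain1 L κ a := by
  induction n using Int.induction_on generalizing a with
  | zero => simp
  | succ n ih =>
    have h1 := ih a
    have h2 := gain1_add_period L κ (a + ((n : ℕ) : ℤ) * (2 * Real.pi / L))
    push_cast at h1 h2 ⊢
    rw [show a + ((n : ℝ) + 1) * (2 * Real.pi / L) = a + n * (2 * Real.pi / L) + 2 * Real.pi / L by ring, h2, h1]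
  | pred n ih =>
    have h1 := ih a
    have h2 := gain1_add_period L κ (a + (-(n : ℝ) - 1) * (2 * Real.pi / L))
    push_cast at h1 ⊢
    rw [show a + (-(n : ℝ) - 1) * (2 * Real.pi / L) + 2 * Real.pi / L = a + -(n : ℝ) * (2 * Real.pi / L) by ring, h1] at h2
    exact h2.symm

/-- `gain1 L κ 0 = 0` and `gain1 L κ (2π/L) = 0`. [folklore] -/
theorem gain1_zero (L : ℕ) (κ : ℝ) : gain1 L κ 0 = 0 := by simp [gain1]

/-- **The slope constant** `c_{L,κ} = gain1 L κ (π/L) · L/π`. [folklore] -/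
def gain1Slope (L : ℕ) (κ : ℝ) : ℝ := gain1 L κ (Real.pi / L) * L / Real.pi

/-- ★ `gain1 L κ (π/L) > 0`: strict concavity at the midpoint of a period with equal end values. [folklore] -/
theorem gain1_half_period_pos (L : ℕ) [NeZero L] {κ : ℝ} (hκ : 0 < κ) : 0 < gain1 L κ (Real.pi / L) := by
  have hL : (0 : ℝ) < L := by exact_mod_cast Nat.pos_of_ne_zero (NeZero.ne L)
  have hp : 0 < 2 * Real.pi / L := by positivity
  have h0 : (0 : ℝ) ∈ Icc 0 (2 * Real.pi / L) := ⟨le_rfl, hp.le⟩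
  have h1 : 2 * Real.pi / L ∈ Icc 0 (2 * Real.pi / L) := ⟨hp.le, le_rfl⟩
  have h := (strictConcaveOn_periodSum L hκ).2 h0 h1 hp.ne (show (0 : ℝ) < 1 / 2 by norm_num)
    (show (0 : ℝ) < 1 / 2 by norm_num) (by norm_num)
  simp only [smul_eq_mul, mul_zero, zero_add] at h
  have hper : periodSum L κ (2 * Real.pi / L) = periodSum L κ 0 := by
    have := gain1_add_period L κ 0
    rw [zero_add, gain1_eq_periodSum_sub, gain1_zero] at this
    linarith
  rw [gain1_eq_periodSum_sub, show Real.pi / L = 1 / 2 * (2 * Real.pi / L) by ring]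
  linarith

/-- ★ The slope constant is positive. [folklore] -/
theorem gain1Slope_pos (L : ℕ) [NeZero L] {κ : ℝ} (hκ : 0 < κ) : 0 < gain1Slope L κ := by
  have hL : (0 : ℝ) < L := by exact_mod_cast Nat.pos_of_ne_zero (NeZero.ne L)
  unfold gain1Slope
  have := gain1_half_period_pos L hκ
  positivity

/-- ★ **Linear lower bound on one period**: for `0 ≤ a ≤ 2π/L`, `gain1Slope L κ · min(a, 2π/L − a) ≤ gain1 L κ a`. [folklore] -/
theorem gain1_ge_slope_mul_min (L : ℕ) [NeZero L] {κ : ℝ} (hκ : 0 < κ) {a : ℝ} (ha0 : 0 ≤ a) (ha1 : a ≤ 2 * Real.pi / L) :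
    gain1Slope L κ * min a (2 * Real.pi / L - a) ≤ gain1 L κ a := by
  have hL : (0 : ℝ) < L := by exact_mod_cast Nat.pos_of_ne_zero (NeZero.ne L)
  have hp : 0 < 2 * Real.pi / L := by positivity
  have hconc := (strictConcaveOn_periodSum L hκ).concaveOn
  have hmid : Real.pi / L ∈ Icc 0 (2 * Real.pi / L) := ⟨by positivity, by rw [div_le_div_iff_of_pos_right hL]; linarith [Real.pi_pos]⟩
  have hper : periodSum L κ (2 * Real.pi / L) = periodSum L κ 0 := by
    have := gain1_add_period L κ 0
    rw [zero_add, gain1_eq_periodSum_sub, gain1_zero] at this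
    linarith
  have hG : gain1 L κ (Real.pi / L) = periodSum L κ (Real.pi / L) - periodSum L κ 0 := gain1_eq_periodSum_sub L κ _
  rw [gain1_eq_periodSum_sub]
  unfold gain1Slope
  have h2p : 2 * Real.pi / L = 2 * (Real.pi / L) := by ring
  rcases le_total a (Real.pi / L) with hle | hge
  · -- first half: `a = t·(π/L) + (1−t)·0`, `t = aL/π`
    rw [min_eq_left (by linarith [h2p])]
    set t : ℝ := a * L / Real.pi with ht
    have ht0 : 0 ≤ t := by positivity
    have ht1 : t ≤ 1 := by
      rw [ht, div_le_one Real.pi_pos]; exact (le_div_iff₀ hL).mp hle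
    have h := hconc.2 hmid ⟨le_rfl, hp.le⟩ ht0 (by linarith) (add_sub_cancel t 1)
    simp only [smul_eq_mul, mul_zero, add_zero] at h
    have hta : t * (Real.pi / L) = a := by
      rw [ht]; field_simp
    rw [hta] at h
    have : gain1 L κ (Real.pi / L) * L / Real.pi * a = t * (periodSum L κ (Real.pi / L) - periodSum L κ 0) := by
      rw [hG, ht]; ring
    rw [this]; linarith
  · -- second half: `a = t·(π/L) + (1−t)·(2π/L)`, `t = (2π/L − a)L/π`
    rw [min_eq_right (by linarith [h2p])]
    set t : ℝ := (2 * Real.pi / L - a) * L / Real.pi with ht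
    have ht0 : 0 ≤ t := by rw [ht]; exact div_nonneg (mul_nonneg (by linarith) hL.le) Real.pi_pos.le
    have ht1 : t ≤ 1 := by
      rw [ht, div_le_one Real.pi_pos, sub_mul, div_mul_cancel₀ _ hL.ne']
      have := (div_le_iff₀ hL).mp hge
      linarith
    have h := hconc.2 hmid ⟨hp.le, le_rfl⟩ ht0 (by linarith) (add_sub_cancel t 1)
    simp only [smul_eq_mul] at h
    have hta : t * (Real.pi / L) + (1 - t) * (2 * Real.pi / L) = a := by
      rw [ht]; field_simp; ring
    rw [hta, hper] at h
    have : gain1 L κ (Real.pi / L) * L / Real.pi * (2 * Real.pi / L - a) =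
        t * (periodSum L κ (Real.pi / L) - periodSum L κ 0) := by
      rw [hG, ht]; ring
    rw [this]; linarith

/-! ## §4 The bound in terms of the distance to `(2π/L)ℤ` and the final VALLEY inequality -/

/-- ★★ **Linear lower bound, all twists**: `gain1Slope L κ · ‖(a : AddCircle (2π/L))‖ ≤ gain1 L κ a`, the norm being the distance of `a` to `(2π/L)ℤ`.
[folklore] -/
theorem gain1_ge_slope_mul_norm (L : ℕ) [NeZero L] {κ : ℝ} (hκ : 0 < κ) (a : ℝ) :
    gain1Slope L κ * ‖((a : ℝ) : AddCircle (2 * Real.pi / L))‖ ≤ gain1 L κ a := by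
  have hL : (0 : ℝ) < L := by exact_mod_cast Nat.pos_of_ne_zero (NeZero.ne L)
  set p : ℝ := 2 * Real.pi / L with hp
  have hp0 : 0 < p := by positivity
  set n : ℤ := round (p⁻¹ * a) with hn
  set a' : ℝ := a - n * p with ha'
  have hnorm : ‖((a : ℝ) : AddCircle p)‖ = |a'| := by rw [AddCircle.norm_eq, ha', hn]
  have hround : |a'| ≤ p / 2 := by
    have h := abs_sub_round (p⁻¹ * a)
    have : a' = p * (p⁻¹ * a - round (p⁻¹ * a)) := by
      rw [ha', hn, mul_sub, ← mul_assoc, mul_inv_cancel₀ hp0.ne', one_mul]; ring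
    rw [this, abs_mul, abs_of_pos hp0]
    have := mul_le_mul_of_nonneg_left h hp0.le
    linarith
  have hga : gain1 L κ a = gain1 L κ a' := by
    have := gain1_add_int_mul_period L κ a' n
    rw [← hp, show a' + n * p = a by rw [ha']; ring] at this
    exact this
  rw [hnorm, hga]
  rcases le_or_gt 0 a' with h0 | h0
  · rw [abs_of_nonneg h0]
    have h := gain1_ge_slope_mul_min L hκ h0 (by rw [← hp]; linarith [abs_le.mp hround])
    rw [← hp, min_eq_left (by linarith [abs_le.mp hround])] at h
    exact h
  · rw [abs_of_neg h0]
    have h1 : 0 ≤ a' + p := by linarith [abs_le.mp hround]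
    have h := gain1_ge_slope_mul_min L hκ h1 (by rw [← hp]; linarith)
    rw [← hp, min_eq_right (by linarith [abs_le.mp hround]), show p - (a' + p) = -a' by ring] at h
    rwa [show a' + p = a' + 2 * Real.pi / L by rw [hp], gain1_add_period] at h

/-- ★★★ **THE VALLEY GAIN**: for every direction `k`, `toronZPE L κ 0 0 + gain1Slope L κ · ‖(α k : AddCircle (2π/L))‖ ≤ toronZPE L κ 0 α` —
the charged-mode zero-point energy of a flat background exceeds its toron value by at least a positive constant (depending on `L`, `κ` only) times the
distance of any one adjoint holonomy phase to `(2π/L)ℤ`. [cite: Luscher1983, §3] -/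
theorem toronZPE_zero_add_slope_mul_norm_le (L : ℕ) [NeZero L] {κ : ℝ} (hκ : 0 < κ) (α : Fin 3 → ℝ) (k : Fin 3) :
    toronZPE L κ 0 (fun _ => 0) + gain1Slope L κ * ‖((α k : ℝ) : AddCircle (2 * Real.pi / L))‖ ≤ toronZPE L κ 0 α :=
  le_trans (by linarith [gain1_ge_slope_mul_norm L hκ (α k)]) (toronZPE_zero_add_gain1_le L hκ α k)

/-- Corollary in `sup`-form: with `d = max_k ‖(α k : AddCircle (2π/L))‖`, `toronZPE L κ 0 0 + gain1Slope L κ · d ≤ toronZPE L κ 0 α`. [folklore] -/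
theorem toronZPE_zero_add_slope_mul_sup_le (L : ℕ) [NeZero L] {κ : ℝ} (hκ : 0 < κ) (α : Fin 3 → ℝ) :
    toronZPE L κ 0 (fun _ => 0) +
        gain1Slope L κ * Finset.univ.sup' Finset.univ_nonempty (fun k => ‖((α k : ℝ) : AddCircle (2 * Real.pi / L))‖) ≤
      toronZPE L κ 0 α := by
  obtain ⟨k, -, hk⟩ := Finset.exists_mem_eq_sup' Finset.univ_nonempty (fun k => ‖((α k : ℝ) : AddCircle (2 * Real.pi / L))‖)
  rw [hk]
  exact toronZPE_zero_add_slope_mul_norm_le L hκ α k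

end Summit.QuantumFields.YangMills.Theorems.FemtoTransferGap.TwoLattice.Toron

end
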